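import Summits.QuantumAdvantage.QuantumAdvantage.Theses.CompactnessLift
import Literature.Computability.Complexity.RelativizedTime
import Literature.Computability.Complexity.TimeBoundsProofs
import Literature.Computability.Complexity.UnaryArithMachines
import Literature.Computability.Complexity.CountingHierarchyProofs

/-!
# Line `coin-padding-slices` for the crux `CompactnessPrinciple` (stmt-QuantumAdvantage-15270)

Strategist line (seat planner-cstrat-stmt-QuantumAdvantage-15270-b1-0, 2026-08-17). It closes the crux
**as typed** through the coin-padding artefact recorded in `Cruxes/CompactnessPrinciple/Disproof.lean`
(`compactnessPrinciple_of_H1`): the route types `BP·DTIME(n^c)` as `bp (DTIME (fun n => n ^ c))`, whose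
coin string is free padding, so the crux follows from the textbook identity

  `H1 : BPP ⊆ ⋃ k, BPTime (fun n => n ^ k)`      (Arora–Barak 2009, Def. 7.2, the `⊆` half;
                                                  `RelativizedTime.lean`: "Not here … none is requested").

`H1` is a genuine Turing-machine construction in the tree's TM2 model: the inner language of
`BPTime t = bpTime t (DTIME fun n => n)` must be decided in time LINEAR in the padded input `⟨x, r⟩`
on EVERY input, so the time budget of the simulated `P`-machine and the coin count `p |x|` have to be
evaluated in unary *against the coins `r` as fuel* (a machine that first computes `p |x|` is not linear
time on inputs with few coins). The line isolates exactly the two machines this needs: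

* `stub_fuelledClock` — the FUEL-GUARDED POLYNOMIAL CLOCK: `w ↦ 1^{p |x|} 0 w` if `B |x| ≤ |r|`, else `[]`
  (`(x, r) = boolUnpair w`), in linear time, for all polynomials `p`, `B`;
* `stub_headerTake` — the HEADER-DRIVEN PREFIX COPY: `1^j 0 w ↦ ⟨x, r ↾ j⟩`, in linear time;

and proves the rest: the composite inner decider (`Turing.TM2ComputableAux.comp`, per-input time
accounting: the simulated machine is paid for by the guard `B |x| ≤ |r| ≤ |w|`), `H1`
(`bpp_subset_iUnion_bpTime`, cylinder events `uniformProb_take_of_le`), and the crux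
(`CompactnessPrinciple_of`, the five lines of `Disproof.compactnessPrinciple_of_H1`).

HONEST LABEL. Zero quantum content; this is NOT progress on the intended uniform-exponent principle
CP′ over `BQTime`/`BPTime` (census `STRATEGY-CENSUS.md` §1–§5, unchanged verdict). What it pays:
(i) item 15270 closes as typed, mechanically confirming the misstatement the refuters recorded;
(ii) `H1` lands — every fixed-exponent statement of the REPAIRED route needs it or its twins
(`BPPSlices` of census D2, `PlImpliesCp′`, the `BPTimeRel` analogue for OracleDichotomy /
GenericWorldCompactness); (iii) the fuelled clock is the reusable tool for `SummitGivesLadder′`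
(padding into `BQTime(n²)`), `UnionTheorem` (15272) and `UnifDiag` (Schöning/Ladner clocks).
Disproof used: `Disproof.lean` has no `_false_without_` theorem (the crux is not refutable short of
`BQP ⊆ BPP`); this line IS its `compactnessPrinciple_of_H1` with `H1` cut into machines.
-/

set_option linter.dupNamespace false
set_option linter.unusedVariables false

noncomputable section

namespace Summit.QuantumAdvantage.QuantumAdvantage.Cruxes.CompactnessPrinciple.CoinPaddingSlices

open Polynomial
open Literature.Computability.Complexity Literature.Computability.Cryptography
open Summit.QuantumAdvantage.QuantumAdvantage.Theses.CompactnessLift (CompactnessPrinciple)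
open _root_.Computability (encodeBool)

/-! ### The two transducers of the inner decider -/

/-- The fuel-guarded polynomial clock: with `(x, r) := boolUnpair w`, output the unary header
`1^{p |x|} 0` followed by `w` verbatim when the budget test `B |x| ≤ |r|` passes, and `[]` otherwise. -/
def clockFn (p B : Polynomial ℕ) (w : List Bool) : List Bool :=
  if B.eval (boolUnpair w).1.length ≤ (boolUnpair w).2.length then
    ones (p.eval (boolUnpair w).1.length) ++ false :: w
  else []

/-- The header-driven prefix copy: read a unary header `1^j 0`, then a pair `⟨x, r⟩`, and output
`⟨x, r ↾ j⟩` (total through `splitOnes` / `boolUnpair`). -/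
def takeFn (v : List Bool) : List Bool :=
  boolPair (boolUnpair (splitOnes v).2).1 (((boolUnpair (splitOnes v).2).2).take (splitOnes v).1)

/-- The composite pre-processor of the inner decider. -/
def gFn (p B : Polynomial ℕ) : List Bool → List Bool := takeFn ∘ clockFn p B

/-- The budget polynomial: `budget p c' k = p + c' (2X + 2 + p)^k + c'` — the coin count plus the
running time of a `c' N^k + c'` decider on the pair `⟨x, y⟩`, `|y| = p |x|`, `N = 2|x| + 2 + p |x|`. -/
def budget (p : Polynomial ℕ) (c' k : ℕ) : Polynomial ℕ :=
  p + (C c' * (C 2 * X + C 2 + p) ^ k + C c')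

@[simp] theorem eval_budget (p : Polynomial ℕ) (c' k n : ℕ) :
    (budget p c' k).eval n = p.eval n + (c' * (2 * n + 2 + p.eval n) ^ k + c') := by
  simp [budget]

theorem clockFn_of_le {p B : Polynomial ℕ} {w : List Bool}
    (h : B.eval (boolUnpair w).1.length ≤ (boolUnpair w).2.length) :
    clockFn p B w = ones (p.eval (boolUnpair w).1.length) ++ false :: w := by
  simp [clockFn, h]

theorem clockFn_of_not_le {p B : Polynomial ℕ} {w : List Bool}
    (h : ¬ B.eval (boolUnpair w).1.length ≤ (boolUnpair w).2.length) :
    clockFn p B w = [] := by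
  simp [clockFn, h]

theorem takeFn_header (j : ℕ) (w : List Bool) :
    takeFn (ones j ++ false :: w) = boolPair (boolUnpair w).1 ((boolUnpair w).2.take j) := by
  simp [takeFn]

theorem takeFn_nil : takeFn [] = [false, true] := by
  simp [takeFn, splitOnes, boolUnpair, boolPair]

/-- On a good pair the pre-processor truncates the coins to the first `p |x|`. -/
theorem gFn_boolPair_of_le {p B : Polynomial ℕ} {x r : List Bool}
    (h : B.eval x.length ≤ r.length) :
    gFn p B (boolPair x r) = boolPair x (r.take (p.eval x.length)) := by
  have h' : B.eval (boolUnpair (boolPair x r)).1.length ≤ (boolUnpair (boolPair x r)).2.length := by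
    simpa using h
  simp only [gFn, Function.comp, clockFn_of_le h', takeFn_header]
  simp

/-- The dichotomy of the pre-processor: guard passes (header + re-paired truncation) or fails
(constant output of length `2`). -/
theorem gFn_dichotomy (p B : Polynomial ℕ) (w : List Bool) :
    (B.eval (boolUnpair w).1.length ≤ (boolUnpair w).2.length ∧
      clockFn p B w = ones (p.eval (boolUnpair w).1.length) ++ false :: w ∧
      gFn p B w = boolPair (boolUnpair w).1 ((boolUnpair w).2.take (p.eval (boolUnpair w).1.length))) ∨
    (¬ B.eval (boolUnpair w).1.length ≤ (boolUnpair w).2.length ∧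
      clockFn p B w = [] ∧ gFn p B w = [false, true]) := by
  by_cases h : B.eval (boolUnpair w).1.length ≤ (boolUnpair w).2.length
  · refine Or.inl ⟨h, clockFn_of_le h, ?_⟩
    simp only [gFn, Function.comp, clockFn_of_le h, takeFn_header]
  · refine Or.inr ⟨h, clockFn_of_not_le h, ?_⟩
    simp only [gFn, Function.comp, clockFn_of_not_le h, takeFn_nil]

/-! ### The two registered stubs (machine constructions, standalone `FinTM2`s over `Bool`) -/

/-- **Stub 1 — the fuel-guarded polynomial clock runs in linear time.** For all polynomials `p`, `B`,
the map `clockFn p B : w ↦ 1^{p |x|} 0 w` (if `B |x| ≤ |r|`, with `(x, r) = boolUnpair w`) `/ []`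
(otherwise) is computable by a TM2 machine within `a |w| + a` steps on EVERY input. Why linear: parse
`w` two symbols at a time (`boolUnpair` semantics, junk included), then count `B |x|` in unary by
nested loops over a unary copy of `|x|`, paying every tick with one symbol of a copy of `r` and
aborting (output `[]`) when the fuel is exhausted — amortised `O(1)` per tick, `O(k |x|)` wasted at an
abort; if the count completes then `B |x| ≤ |r| ≤ |w|` and `p |x| ≤ B |x|` is counted the same way.
Size L–XL (shape of `UnaryArithMachines.MulTM` with a fuel stack). [AroraBarakCC2009, §1.3, §3.1] -/
theorem stub_fuelledClock :
    ∀ p B : Polynomial ℕ, ∃ a : ℕ, TimeComputable id id (clockFn p B) fun n => a * n + a := by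
  sorry

/-- **Stub 2 — the header-driven prefix copy runs in linear time.** `takeFn : 1^j 0 ⟨x, r⟩ ↦ ⟨x, r ↾ j⟩`
(total via `splitOnes`/`boolUnpair`) is computable within `a |v| + a` steps: count the header onto a
counter stack, copy the doubled pairs of `x` and the separator, then copy symbols of `r` while popping
the counter, discard the rest. Size M–L (shape of `RePairTM` / `PairFstTM`). [AroraBarakCC2009, §0.1, §1.3] -/
theorem stub_headerTake : ∃ a : ℕ, TimeComputable id id takeFn fun n => a * n + a := by
  sorry

/-! ### Composition (proved): the inner decider, `H1`, and the crux -/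

/-- Monotonicity of `uniformProb` through the strings of the sampled length. -/
theorem uniformProb_mono_len {m : ℕ} {E E' : Set (List Bool)}
    (h : ∀ r : List Bool, r.length = m → r ∈ E → r ∈ E') : uniformProb m E ≤ uniformProb m E' := by
  classical
  unfold uniformProb
  refine div_le_div_of_nonneg_right ?_ (by positivity)
  exact_mod_cast Finset.card_le_card fun v hv => by
    simp only [Finset.mem_filter, Finset.mem_univ, true_and] at hv ⊢
    exact h _ v.toList_length hv

/-- The arithmetic of the per-input time bound of the composite inner decider. -/
theorem time_bound (a₁ a₂ c' k n g cl : ℕ)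
    (hg : c' * g ^ k + c' ≤ n ∨ g = 2) (hcl : cl ≤ 2 * n + 1) :
    c' * g ^ k + c' + ((a₂ * cl + a₂) + (a₁ * n + a₁)) ≤
      (1 + 2 * a₂ + a₁ + c' * 2 ^ k + c') * n + (1 + 2 * a₂ + a₁ + c' * 2 ^ k + c') := by
  have h1 : a₂ * cl ≤ a₂ * (2 * n + 1) := Nat.mul_le_mul_left _ hcl
  rcases hg with hg | rfl
  · calc c' * g ^ k + c' + ((a₂ * cl + a₂) + (a₁ * n + a₁))
        ≤ n + ((a₂ * (2 * n + 1) + a₂) + (a₁ * n + a₁)) := by omega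
      _ = (1 + 2 * a₂ + a₁) * n + (2 * a₂ + a₁) := by ring
      _ ≤ (1 + 2 * a₂ + a₁ + c' * 2 ^ k + c') * n + (1 + 2 * a₂ + a₁ + c' * 2 ^ k + c') :=
          Nat.add_le_add (Nat.mul_le_mul_right _ (by omega)) (by omega)
  · calc c' * 2 ^ k + c' + ((a₂ * cl + a₂) + (a₁ * n + a₁))
        ≤ c' * 2 ^ k + c' + ((a₂ * (2 * n + 1) + a₂) + (a₁ * n + a₁)) := by omega
      _ = (2 * a₂ + a₁) * n + (c' * 2 ^ k + c' + 2 * a₂ + a₁) := by ring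
      _ ≤ (1 + 2 * a₂ + a₁ + c' * 2 ^ k + c') * n + (1 + 2 * a₂ + a₁ + c' * 2 ^ k + c') :=
          Nat.add_le_add (Nat.mul_le_mul_right _ (by omega)) (by omega)

/-- **The inner decider.** For `L' ∈ DTIME(n^k)` with constant `c'` and coin polynomial `p`, the
preimage `{w | gFn p (budget p c' k) w ∈ L'}` is decided in LINEAR time: clock, take, then the
`L'`-decider, composed by `Turing.TM2ComputableAux.comp` (additive per-input time); on guard-passing
inputs the third phase costs `≤ B |x| ≤ |r| ≤ |w|`, on the others it runs on the constant `[0,1]`. -/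
theorem preimage_mem_DTIME_id
    (h₁ : ∀ p B : Polynomial ℕ, ∃ a : ℕ, TimeComputable id id (clockFn p B) fun n => a * n + a)
    (h₂ : ∃ a : ℕ, TimeComputable id id takeFn fun n => a * n + a) {L' : Language Bool} {k c' : ℕ}
    (p : Polynomial ℕ) (hL' : L' ∈ TimeClass fun n => c' * n ^ k + c') :
    {w : List Bool | gFn p (budget p c' k) w ∈ L'} ∈ DTIME fun n => n := by
  set B := budget p c' k with hB
  obtain ⟨a₁, M₁, hM₁⟩ := h₁ p B
  obtain ⟨a₂, M₂, hM₂⟩ := h₂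
  obtain ⟨M', hM'⟩ := hL'
  refine ⟨1 + 2 * a₂ + a₁ + c' * 2 ^ k + c', (M₁.comp M₂).comp M', fun w => ?_⟩
  have e₁ : M₁.OutputsWithin w (clockFn p B w) (a₁ * w.length + a₁) := hM₁ w
  have e₂ : M₂.OutputsWithin (clockFn p B w) (gFn p B w) (a₂ * (clockFn p B w).length + a₂) := hM₂ _
  have e₃ : M'.OutputsWithin (gFn p B w) (encodeBool (L'.boolIndicator (gFn p B w)))
      (c' * (gFn p B w).length ^ k + c') := hM' _
  have e := Turing.TM2ComputableAux.comp_outputsWithin _ _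
    (Turing.TM2ComputableAux.comp_outputsWithin _ _ e₁ e₂) e₃
  have hind : Set.boolIndicator {w : List Bool | gFn p B w ∈ L'} w = L'.boolIndicator (gFn p B w) := rfl
  show ((M₁.comp M₂).comp M').OutputsWithin w (encodeBool (Set.boolIndicator {w : List Bool | gFn p B w ∈ L'} w))
    ((1 + 2 * a₂ + a₁ + c' * 2 ^ k + c') * w.length + (1 + 2 * a₂ + a₁ + c' * 2 ^ k + c'))
  rw [hind]
  refine e.mono (time_bound a₁ a₂ c' k w.length (gFn p B w).length (clockFn p B w).length ?_ ?_)
  · rcases gFn_dichotomy p B w with ⟨hguard, -, hg⟩ | ⟨-, -, hg⟩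
    · left
      have hparts := length_boolUnpair_parts_le w
      set x := (boolUnpair w).1
      set r := (boolUnpair w).2
      have hpB : p.eval x.length ≤ B.eval x.length := by rw [hB, eval_budget]; omega
      have htake : (r.take (p.eval x.length)).length = p.eval x.length :=
        List.length_take_of_le (hpB.trans hguard)
      have hlen : (gFn p B w).length = 2 * x.length + 2 + p.eval x.length := by
        rw [hg, length_boolPair, htake]
      have hbud : c' * (2 * x.length + 2 + p.eval x.length) ^ k + c' ≤ B.eval x.length := by
        rw [hB, eval_budget]; omega
      rw [hlen]
      omega
    · right
      rw [hg]
      rfl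
  · rcases gFn_dichotomy p B w with ⟨hguard, hc, -⟩ | ⟨-, hc, -⟩
    · have hparts := length_boolUnpair_parts_le w
      have hpB : p.eval (boolUnpair w).1.length ≤ B.eval (boolUnpair w).1.length := by
        rw [hB, eval_budget]; omega
      rw [hc]
      simp only [List.length_append, List.length_replicate, List.length_cons]
      omega
    · rw [hc]
      simp

/-- **`H1` from the two stubs**: `BPP ⊆ ⋃ k, BPTIME(n^k)` (Arora–Barak 2009, Def. 7.2, `⊆`). Given
`L ∈ bp P` through `L' ∈ DTIME(n^k)` (constant `c'`) and coins `p |x|`, take `B = budget p c' k`,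
`c₃ |x|^K + c₃ ≥ B |x|` coins, and the linear-time inner language `{w | gFn p B w ∈ L'}`; on coin strings of
the prescribed length the guard passes and the verdict is that of `L'` on the first `p |x|` coins,
whose success probability is the cylinder-event probability `uniformProb_take_of_le`. -/
theorem bpp_subset_iUnion_bpTime
    (h₁ : ∀ p B : Polynomial ℕ, ∃ a : ℕ, TimeComputable id id (clockFn p B) fun n => a * n + a)
    (h₂ : ∃ a : ℕ, TimeComputable id id takeFn fun n => a * n + a) :
    BPP ⊆ ⋃ k : ℕ, BPTime fun n => n ^ k := by
  intro L hL
  obtain ⟨L', hL'P, p, hbp⟩ := hL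
  obtain ⟨k, hk⟩ := Set.mem_iUnion.1 hL'P
  obtain ⟨c', hc'⟩ := hk
  set B := budget p c' k with hB
  have hL'' := preimage_mem_DTIME_id h₁ h₂ p hc'
  obtain ⟨c₃, K, hc₃⟩ := exists_eval_le_mul_pow_add B
  refine Set.mem_iUnion.2 ⟨K, {w : List Bool | gFn p B w ∈ L'}, hL'', c₃, fun x => ?_⟩
  have hpB : p.eval x.length ≤ B.eval x.length := by rw [hB, eval_budget]; omega
  have hBm : B.eval x.length ≤ c₃ * x.length ^ K + c₃ := hc₃ _
  have hx := hbp x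
  rw [← uniformProb_take_of_le (hpB.trans hBm) {y : List Bool | boolPair x y ∈ L' ↔ x ∈ L}] at hx
  refine hx.trans (uniformProb_mono_len fun r hr hrE => ?_)
  have hguard : B.eval x.length ≤ r.length := hr ▸ hBm
  have hg : gFn p B (boolPair x r) = boolPair x (r.take (p.eval x.length)) := gFn_boolPair_of_le hguard
  simp only [Set.mem_setOf_eq] at hrE
  show gFn p B (boolPair x r) ∈ L' ↔ x ∈ L
  rw [hg]
  exact hrE

/-- `QuadQ`, the route's inlined comprehension (verbatim), lies in `BQP` (as in `Disproof.lean`). -/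
theorem quadQ_subset_BQP :
    {L : Language Bool | ∃ F : QCircuitFamily cliffordT, F.IsOracleFree ∧
      (∃ C : ℕ, TimeComputable _root_.Computability.unaryEncodeNat (QCircuit.sigmaEncode (G := cliffordT))
        (fun n => (⟨n, F.ancillas n, F.circ n⟩ : Σ n m : ℕ, QCircuit cliffordT (n + m)))
        (fun n => C * n ^ 2 + C)) ∧
      ∀ x, (x ∈ L → 2 / 3 ≤ F.acceptProbOn 0 x) ∧ (x ∉ L → F.acceptProbOn 0 x ≤ 1 / 3)} ⊆ BQP := by
  rintro L ⟨F, hfree, ⟨C, hT⟩, hgap⟩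
  rw [ClassBQP.mem_BQP_iff]
  refine ⟨F, hfree, ⟨Polynomial.C C * Polynomial.X ^ 2 + Polynomial.C C, ?_⟩, hgap⟩
  exact hT.mono fun n => le_of_eq (by simp)

/-- Under `H1`, `BPP ⊆ bp (DTIME n^c)` for every `c ≥ 1` (coins are free padding; tree lemma
`bpTime_pow_subset_bp`). -/
theorem BPP_subset_bp_DTIME_pow (h : BPP ⊆ ⋃ k : ℕ, BPTime fun n => n ^ k) {c : ℕ} (hc : 1 ≤ c) :
    BPP ⊆ bp (DTIME fun n => n ^ c) := by
  intro L hL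
  obtain ⟨k, hk⟩ := Set.mem_iUnion.1 (h hL)
  have h₁ : L ∈ bp (DTIME fun n => n) := bpTime_pow_subset_bp (DTIME fun n => n) k hk
  exact bp_mono (DTIME_mono fun n => Nat.le_self_pow (by omega) n) h₁

/-- **The line concludes the crux BY NAME** from the registered stubs (the only `sorry`s of the file
are inside `stub_fuelledClock`, `stub_headerTake`): `H1` from the stubs, then `c = 1` — coins are free
padding (`BPP_subset_bp_DTIME_pow`) and `QuadQ ⊆ BQP ⊆ BPP` under the crux's hypothesis. A prover who has
turned the stubs into theorems re-uses this proof verbatim. -/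
theorem CompactnessPrinciple_of : CompactnessPrinciple := by
  intro hsub
  exact ⟨1, fun L hL => BPP_subset_bp_DTIME_pow
    (bpp_subset_iUnion_bpTime stub_fuelledClock stub_headerTake) le_rfl (hsub (quadQ_subset_BQP hL))⟩

end Summit.QuantumAdvantage.QuantumAdvantage.Cruxes.CompactnessPrinciple.CoinPaddingSlices
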